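import Summits.AtomisticToContinuum.Crystallization.Theorems.UniformPolytypeStability.Negative.Rows
import Summits.AtomisticToContinuum.Crystallization.Theorems.PricedLinkCensusSoftLayerPropagationBasics
import Summits.AtomisticToContinuum.Crystallization.Theorems.ShellsToLayers.Negative.UniformTauNoWindow

/-!
# `UniformPolytypeStability` (stmt-AtomisticToContinuum-15800), negative side III: the upper bound `a ≤ 1` is load-bearing

Part III of the standing disprover's load-bearing analysis of crux `UniformPolytypeStability`
(route `DisclinationRation`).  MUTATED STATEMENT: the crux's window `Box` with the conjunct
`a ≤ 1` deleted, `UniformPolytypeStabilityOn (fun a s z => 47/50 ≤ a ∧ IsHaggSeq s ∧ HeightBox a z)`.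
It is FALSE (`uniformPolytypeStability_false_without_upperA`), by a DILATION witness with no
numerics: the fcc word at uniform heights `4a/5·m` gives the Bravais lattice `L_a = a·L₁`
(parts I–II: in the height box, force balanced for every `a`), and for the single-site
displacement `eᵢ·𝟙_{0}` the second variation is `2Σ'_{y∈L_a∖0} eᵢᵀK(y)eᵢ = 2(a⁻⁸S₈(eᵢ) +
a⁻¹⁴S₁₄(eᵢ))` (exact scaling of `V′ = −r⁻¹³ + r⁻⁷`, `V″ = 13r⁻¹⁴ − 7r⁻⁸`), where
`S₈(ξ) = Σ'|x|⁻⁸(1 − 8cos²)` satisfies `Σᵢ S₈(eᵢ) = −5Σ'_{x∈L₁∖0}|x|⁻⁸ < 0`; so some axis has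
`S₈(eᵢ) < 0` (pigeonhole — no lattice-sum evaluation), and `a = max 1 (|S₁₄|/(−S₈) + 1)` makes the
second variation negative while `κ·N(u) ≥ 0`.  Hence ANY proof of the crux must use `a ≤ 1`
quantitatively; the disprover's Bloch scan puts the true instability edge at `a ≈ 1.055`
(`h = 0.85a`) / `a ≈ 1.06` (`h = √(2/3)a`), within `6 %` of the crux's edge.  All `[folklore]`.
-/

noncomputable section

namespace Summit.AtomisticToContinuum.Crystallization.Theorems.UniformPolytypeStabilityNegative

open scoped BigOperators Topology Classical InnerProductSpace
open Filter Set Function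
open Literature.MathematicalPhysics.StatisticalMechanics
open Summit.AtomisticToContinuum.Crystallization.Theorems.PhononStabilityNegative

local notation "E3" => EuclideanSpace ℝ (Fin 3)

/-! ## The dilation witness -/

section Dilation

/-- `4/5 ≠ 0`. [folklore] -/
theorem four_fifths_ne : (4 / 5 : ℝ) ≠ 0 := by norm_num

/-- The unit witness lattice `L₁ = ℤu + ℤv + ℤ(w + (4/5)e₃)` (fcc word, `a = 1`, `h = 4/5`). [folklore] -/
def L₁ : Submodule ℤ E3 := fccLat one_ne_zero four_fifths_ne

/-- `L₁` is discrete. [folklore] -/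
instance : DiscreteTopology L₁ := by unfold L₁; infer_instance

/-- `rank L₁ = 3`. [folklore] -/
theorem finrank_L₁ : Module.finrank ℤ L₁ = 3 := finrank_fccLat _ _

/-- `4a/5 ≠ 0` for `a ≠ 0`. [folklore] -/
theorem ha45 {a : ℝ} (ha : a ≠ 0) : 4 * a / 5 ≠ 0 := by
  intro h; apply ha; linarith

/-- The dilated witness lattice `L_a = ℤu_a + ℤv_a + ℤ(w_a + (4a/5)e₃)`. [folklore] -/
def La {a : ℝ} (ha : a ≠ 0) : Submodule ℤ E3 := fccLat ha (ha45 ha)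

/-- `L_a` is discrete. [folklore] -/
instance {a : ℝ} (ha : a ≠ 0) : DiscreteTopology (La ha) := by unfold La; infer_instance

/-- `L_a = a · L₁` pointwise. [folklore] -/
theorem mem_La_iff {a : ℝ} (ha : a ≠ 0) (g : E3) : g ∈ La ha ↔ ∃ x ∈ L₁, g = a • x := by
  unfold La L₁
  rw [mem_fccLat_iff]
  constructor
  · rintro ⟨m, i, j, rfl⟩
    refine ⟨(i : ℝ) • triangularVec₁ 1 + (j : ℝ) • triangularVec₂ 1 + (m : ℝ) • barlowOffset 1 +
      (m : ℝ) • layerNormal (4 / 5), (mem_fccLat_iff _ _ _).2 ⟨m, i, j, rfl⟩, ?_⟩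
    rw [triangularVec₁_eq_smul a, triangularVec₂_eq_smul a, barlowOffset_eq_smul a,
      show (4 * a / 5 : ℝ) = a * (4 / 5) by ring, layerNormal_eq_smul]
    simp only [smul_add, smul_comm (_ : ℝ) a]
  · rintro ⟨x, hx, rfl⟩
    obtain ⟨m, i, j, rfl⟩ := (mem_fccLat_iff _ _ _).1 hx
    refine ⟨m, i, j, ?_⟩
    rw [triangularVec₁_eq_smul a, triangularVec₂_eq_smul a, barlowOffset_eq_smul a,
      show (4 * a / 5 : ℝ) = a * (4 / 5) by ring, layerNormal_eq_smul]
    simp only [smul_add, smul_comm (_ : ℝ) a]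

/-- The scaling bijection `L₁ ≃ L_a`, `x ↦ a·x`. [folklore] -/
def scaleEquiv {a : ℝ} (ha : a ≠ 0) : L₁ ≃ La ha where
  toFun x := ⟨a • (x : E3), (mem_La_iff ha _).2 ⟨x, x.2, rfl⟩⟩
  invFun y := ⟨a⁻¹ • (y : E3), by
    obtain ⟨x, hx, hy⟩ := (mem_La_iff ha (y : E3)).1 y.2
    rw [hy, smul_smul, inv_mul_cancel₀ ha, one_smul]; exact hx⟩
  left_inv x := Subtype.ext (by simp [smul_smul, inv_mul_cancel₀ ha])
  right_inv y := Subtype.ext (by simp [smul_smul, mul_inv_cancel₀ ha])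

/-- `scaleEquiv x = a·x` as vectors. [folklore] -/
@[simp] theorem coe_scaleEquiv {a : ℝ} (ha : a ≠ 0) (x : L₁) :
    ((scaleEquiv ha x : La ha) : E3) = a • (x : E3) := rfl

/-- Nonzero vectors of `L₁` have norm `≥ 4/5`. [folklore] -/
theorem norm_ge_of_mem_L₁ {x : E3} (hx : x ∈ L₁) (hx0 : x ≠ 0) : (4 / 5 : ℝ) ≤ ‖x‖ := by
  have := min_le_norm_of_mem_fccLat (a := 1) (h := 4 / 5) one_pos (by norm_num) hx hx0
  refine le_trans ?_ this
  rw [min_eq_right (by norm_num)]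

/-- Nonzero vectors of `L_a` have norm `≥ 4a/5 ≥ 1/2` once `a ≥ 1`. [folklore] -/
theorem norm_ge_of_mem_La {a : ℝ} (ha1 : 1 ≤ a) {y : E3} (hy : y ∈ La (by positivity : a ≠ 0))
    (hy0 : y ≠ 0) : (1 / 2 : ℝ) ≤ ‖y‖ := by
  have ha : 0 < a := by positivity
  have := min_le_norm_of_mem_fccLat (a := a) (h := 4 * a / 5) ha (by positivity) hy hy0
  refine le_trans ?_ this
  rw [min_eq_right (by linarith)]
  linarith

/-! ### The scaling law of the force-constant form -/

/-- `ξᵀK(a x)ξ = a⁻⁸·|x|⁻⁸(1 − 8c²) + a⁻¹⁴·|x|⁻¹⁴(14c² − 1)`, `c = ⟪x,ξ⟫/|x|`, for `x ≠ 0`,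
`a > 0`, `‖ξ‖ = 1` (from `V′(r) = −r⁻¹³ + r⁻⁷`, `V″(r) = 13r⁻¹⁴ − 7r⁻⁸`). [folklore] -/
theorem Hess₀_smul {a : ℝ} (ha : 0 < a) {x : E3} (hx : x ≠ 0) {ξ : E3} (hξ : ‖ξ‖ = 1) :
    Hess₀ (a • x) ξ =
      (a⁻¹) ^ 8 * ((‖x‖⁻¹) ^ 8 * (1 - 8 * (inner ℝ x ξ / ‖x‖) ^ 2)) +
        (a⁻¹) ^ 14 * ((‖x‖⁻¹) ^ 14 * (14 * (inner ℝ x ξ / ‖x‖) ^ 2 - 1)) := by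
  have hxn : 0 < ‖x‖ := norm_pos_iff.2 hx
  have han : ‖a • x‖ = a * ‖x‖ := by rw [norm_smul, Real.norm_eq_abs, abs_of_pos ha]
  have hne : a * ‖x‖ ≠ 0 := by positivity
  have hc : inner ℝ (a • x) ξ / ‖a • x‖ = inner ℝ x ξ / ‖x‖ := by
    rw [han, real_inner_smul_left, mul_div_mul_left _ _ ha.ne']
  unfold Hess₀
  rw [hc, han, deriv_deriv_lennardJones hne, deriv_lennardJones hne, hξ, mul_inv]
  ring

/-- The `r⁻⁸` coefficient row: `G₈(x) = |x|⁻⁸(1 − 8c²)` off the origin. [folklore] -/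
def G₈ (ξ : E3) (x : L₁) : ℝ :=
  if x = 0 then 0 else (‖(x : E3)‖⁻¹) ^ 8 * (1 - 8 * (inner ℝ (x : E3) ξ / ‖(x : E3)‖) ^ 2)

/-- The `r⁻¹⁴` coefficient row: `G₁₄(x) = |x|⁻¹⁴(14c² − 1)` off the origin. [folklore] -/
def G₁₄ (ξ : E3) (x : L₁) : ℝ :=
  if x = 0 then 0 else (‖(x : E3)‖⁻¹) ^ 14 * (14 * (inner ℝ (x : E3) ξ / ‖(x : E3)‖) ^ 2 - 1)

/-- `c² ≤ 1` for the direction cosine `c = ⟪x,ξ⟫/|x|`, `‖ξ‖ = 1`. [folklore] -/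
theorem cos_sq_le_one (x : E3) {ξ : E3} (hξ : ‖ξ‖ = 1) : (inner ℝ x ξ / ‖x‖) ^ 2 ≤ 1 := by
  rcases eq_or_ne x 0 with rfl | hx
  · simp
  · have hpos : 0 < ‖x‖ := norm_pos_iff.2 hx
    have hcs : |inner ℝ x ξ| ≤ ‖x‖ * ‖ξ‖ := abs_real_inner_le_norm x ξ
    rw [hξ, mul_one] at hcs
    have : |inner ℝ x ξ / ‖x‖| ≤ 1 := by
      rw [abs_div, abs_of_pos hpos, div_le_one hpos]; exact hcs
    have h2 : (inner ℝ x ξ / ‖x‖) ^ 2 = |inner ℝ x ξ / ‖x‖| ^ 2 := (sq_abs _).symm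
    rw [h2]
    nlinarith [abs_nonneg (inner ℝ x ξ / ‖x‖)]

/-- `|G₈| ≤ 7|x|⁻⁸`. [folklore] -/
theorem abs_G₈_le {ξ : E3} (hξ : ‖ξ‖ = 1) (x : L₁) : |G₈ ξ x| ≤ 7 * (‖(x : E3)‖⁻¹) ^ 8 := by
  unfold G₈
  split_ifs with hx
  · rw [abs_zero]; positivity
  · rw [abs_mul, abs_of_nonneg (by positivity : (0 : ℝ) ≤ (‖(x : E3)‖⁻¹) ^ 8), mul_comm]
    refine mul_le_mul_of_nonneg_right ?_ (by positivity)
    have h1 := cos_sq_le_one (x : E3) hξ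
    have h0 : 0 ≤ (inner ℝ (x : E3) ξ / ‖(x : E3)‖) ^ 2 := sq_nonneg _
    exact abs_le.2 ⟨by linarith, by linarith⟩

/-- `|G₁₄| ≤ 13|x|⁻¹⁴`. [folklore] -/
theorem abs_G₁₄_le {ξ : E3} (hξ : ‖ξ‖ = 1) (x : L₁) : |G₁₄ ξ x| ≤ 13 * (‖(x : E3)‖⁻¹) ^ 14 := by
  unfold G₁₄
  split_ifs with hx
  · rw [abs_zero]; positivity
  · rw [abs_mul, abs_of_nonneg (by positivity : (0 : ℝ) ≤ (‖(x : E3)‖⁻¹) ^ 14), mul_comm]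
    refine mul_le_mul_of_nonneg_right ?_ (by positivity)
    have h1 := cos_sq_le_one (x : E3) hξ
    have h0 : 0 ≤ (inner ℝ (x : E3) ξ / ‖(x : E3)‖) ^ 2 := sq_nonneg _
    exact abs_le.2 ⟨by linarith, by linarith⟩

/-- Lattice sums of `|x|⁻ⁿ` over `L₁` converge for `n > 3`. [folklore] -/
theorem summable_inv_pow_L₁ {n : ℕ} (hn : 3 < n) : Summable fun x : L₁ => (‖(x : E3)‖⁻¹) ^ n := by
  have := ZLattice.summable_norm_sub_inv_pow L₁ n (by rw [finrank_L₁]; exact hn) 0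
  simpa only [sub_zero] using this

/-- `G₈` is summable. [folklore] -/
theorem summable_G₈ {ξ : E3} (hξ : ‖ξ‖ = 1) : Summable (G₈ ξ) :=
  Summable.of_norm_bounded ((summable_inv_pow_L₁ (by norm_num : 3 < 8)).mul_left 7) fun x => by
    rw [Real.norm_eq_abs]; exact abs_G₈_le hξ x

/-- `G₁₄` is summable. [folklore] -/
theorem summable_G₁₄ {ξ : E3} (hξ : ‖ξ‖ = 1) : Summable (G₁₄ ξ) :=
  Summable.of_norm_bounded ((summable_inv_pow_L₁ (by norm_num : 3 < 14)).mul_left 13) fun x => by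
    rw [Real.norm_eq_abs]; exact abs_G₁₄_le hξ x

/-- The two lattice constants `S₈(ξ) = Σ' G₈`, `S₁₄(ξ) = Σ' G₁₄`. [folklore] -/
def S₈ (ξ : E3) : ℝ := ∑' x : L₁, G₈ ξ x

/-- `S₁₄(ξ) = Σ' G₁₄`. [folklore] -/
def S₁₄ (ξ : E3) : ℝ := ∑' x : L₁, G₁₄ ξ x

/-- **The dilated row sum scales:** `Σ'_{y ∈ L_a} H(y) = a⁻⁸ S₈(ξ) + a⁻¹⁴ S₁₄(ξ)`. [folklore] -/
theorem tsum_Hrow_La {a : ℝ} (ha1 : 1 ≤ a) {ξ : E3} (hξ : ‖ξ‖ = 1) :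
    ∑' y : La (by positivity : a ≠ 0), Hrow (La (by positivity : a ≠ 0)) ξ y =
      (a⁻¹) ^ 8 * S₈ ξ + (a⁻¹) ^ 14 * S₁₄ ξ := by
  have ha : 0 < a := by positivity
  have ha' : a ≠ 0 := ha.ne'
  rw [← Equiv.tsum_eq (scaleEquiv ha')]
  have hterm : ∀ x : L₁, Hrow (La ha') ξ (scaleEquiv ha' x) =
      (a⁻¹) ^ 8 * G₈ ξ x + (a⁻¹) ^ 14 * G₁₄ ξ x := by
    intro x
    unfold Hrow G₈ G₁₄
    by_cases hx : x = 0
    · subst hx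
      have : scaleEquiv ha' (0 : L₁) = 0 := Subtype.ext (by simp)
      rw [this, if_pos rfl, if_pos rfl, if_pos rfl]; ring
    · have hx' : (x : E3) ≠ 0 := fun h => hx (Submodule.coe_eq_zero.1 h)
      have hsx : scaleEquiv ha' x ≠ 0 := by
        intro h
        have : ((scaleEquiv ha' x : La ha') : E3) = 0 := by rw [h]; rfl
        rw [coe_scaleEquiv] at this
        exact hx' ((smul_eq_zero.1 this).resolve_left ha')
      rw [if_neg hsx, if_neg hx, if_neg hx, coe_scaleEquiv, Hess₀_smul ha hx' hξ]
  rw [tsum_congr hterm, ((summable_G₈ hξ).mul_left _).tsum_add ((summable_G₁₄ hξ).mul_left _),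
    tsum_mul_left, tsum_mul_left]
  rfl

/-! ### Pigeonhole over the three axes: some `S₈(eᵢ) < 0` -/

/-- The coordinate unit vector `eᵢ`. [folklore] -/
def eAx (i : Fin 3) : E3 := EuclideanSpace.single i (1 : ℝ)

/-- `‖eᵢ‖ = 1`. [folklore] -/
theorem norm_eAx (i : Fin 3) : ‖eAx i‖ = 1 := by
  rw [eAx, PiLp.norm_single, norm_one]

/-- `⟪x, eᵢ⟫ = xᵢ`. [folklore] -/
theorem inner_eAx (x : E3) (i : Fin 3) : inner ℝ x (eAx i) = x i := by
  rw [eAx, EuclideanSpace.inner_single_right]; simp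

/-- `Σᵢ cᵢ² = 1` for the direction cosines of `x ≠ 0`. [folklore] -/
theorem sum_cos_sq {x : E3} (hx : x ≠ 0) : ∑ i : Fin 3, (inner ℝ x (eAx i) / ‖x‖) ^ 2 = 1 := by
  have hpos : 0 < ‖x‖ := norm_pos_iff.2 hx
  simp only [inner_eAx, div_pow]
  rw [← Finset.sum_div, div_eq_one_iff_eq (by positivity)]
  rw [EuclideanSpace.norm_sq_eq]
  exact Finset.sum_congr rfl fun i _ => by rw [Real.norm_eq_abs, sq_abs]

/-- The bare lattice sum row `Z(x) = |x|⁻⁸` off the origin. [folklore] -/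
def Z₈ (x : L₁) : ℝ := if x = 0 then 0 else (‖(x : E3)‖⁻¹) ^ 8

/-- `Σᵢ G₈(eᵢ)(x) = −5·Z(x)`. [folklore] -/
theorem sum_G₈_eAx (x : L₁) : ∑ i : Fin 3, G₈ (eAx i) x = -5 * Z₈ x := by
  unfold G₈ Z₈
  by_cases hx : x = 0
  · simp [hx]
  · have hx' : (x : E3) ≠ 0 := fun h => hx (Submodule.coe_eq_zero.1 h)
    simp only [if_neg hx]
    rw [← Finset.mul_sum, Finset.sum_sub_distrib, ← Finset.mul_sum, sum_cos_sq hx']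
    simp
    ring

/-- `Z` is summable. [folklore] -/
theorem summable_Z₈ : Summable Z₈ := by
  refine Summable.of_norm_bounded (summable_inv_pow_L₁ (by norm_num : 3 < 8)) fun x => ?_
  unfold Z₈
  split_ifs <;> simp

/-- `u = (1,0,0) ∈ L₁`. [folklore] -/
theorem triangularVec₁_mem_L₁ : triangularVec₁ 1 ∈ L₁ :=
  (mem_fccLat_iff _ _ _).2 ⟨0, 1, 0, by simp⟩

/-- The bare lattice sum is positive: `Σ' Z ≥ Z(u) = 1`. [folklore] -/
theorem tsum_Z₈_pos : 0 < ∑' x, Z₈ x := by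
  set u₀ : L₁ := ⟨triangularVec₁ 1, triangularVec₁_mem_L₁⟩
  have hu : Z₈ u₀ = 1 := by
    have hne : u₀ ≠ 0 := by
      intro h
      have : ((u₀ : L₁) : E3) = 0 := by rw [h]; rfl
      have hn := ShellsToLayers.Negative.norm_triangularVec₁_one
      rw [show triangularVec₁ (1 : ℝ) = (u₀ : E3) from rfl, this, norm_zero] at hn
      norm_num at hn
    unfold Z₈
    rw [if_neg hne, show ((u₀ : L₁) : E3) = triangularVec₁ 1 from rfl,
      ShellsToLayers.Negative.norm_triangularVec₁_one]
    norm_num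
  have hle : Z₈ u₀ ≤ ∑' x, Z₈ x :=
    summable_Z₈.le_tsum u₀ fun x _ => by unfold Z₈; split_ifs <;> positivity
  linarith

/-- **Pigeonhole:** `Σᵢ S₈(eᵢ) = −5·Σ'Z < 0`, hence `S₈(eᵢ) < 0` for some axis `i`. [folklore] -/
theorem exists_S₈_neg : ∃ i : Fin 3, S₈ (eAx i) < 0 := by
  have hsum : ∑ i : Fin 3, S₈ (eAx i) = -5 * ∑' x, Z₈ x := by
    unfold S₈
    rw [← Summable.tsum_finsetSum (fun i _ => summable_G₈ (norm_eAx i))]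
    rw [tsum_congr sum_G₈_eAx, tsum_mul_left]
  by_contra h
  push Not at h
  have : 0 ≤ ∑ i : Fin 3, S₈ (eAx i) := Finset.sum_nonneg fun i _ => h i
  linarith [tsum_Z₈_pos]

/-! ### The refutation -/

/-- **The upper bound `a ≤ 1` on the in-layer spacing is load-bearing.**  On the window
`47/50 ≤ a ∧ IsHaggSeq s ∧ HeightBox a z` (the crux's `Box` without `a ≤ 1`) uniform polytype
stability FAILS: the dilated fcc lattice `L_a` (word `constHagg`, uniform heights `4a/5·m`, in the
height box and force balanced for every `a`) carries the single-site displacement `eᵢ·𝟙_{0}` whose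
second variation is `2(a⁻⁸S₈(eᵢ) + a⁻¹⁴S₁₄(eᵢ))` with `Σᵢ S₈(eᵢ) = −5Σ'_{x≠0}|x|⁻⁸ < 0`; for the
axis with `S₈ < 0` and `a = max 1 (|S₁₄|/(−S₈) + 1)` it is negative, while `κ·N(u) ≥ 0`.
Physically: a uniformly dilated LJ crystal sits on the concave `r⁻⁶` tail and is harmonically
unstable; numerically the instability already starts at `a ≈ 1.06` (`h = √(2/3)a`) resp.
`a ≈ 1.055` (`h = 0.85a`), i.e. within `6 %` of the crux's edge `a = 1` (disprover's Bloch
scan, Disproof.lean Part V). [folklore] -/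
theorem uniformPolytypeStability_false_without_upperA :
    ¬ UniformPolytypeStabilityOn fun a s z => 47 / 50 ≤ a ∧ IsHaggSeq s ∧ HeightBox a z := by
  rintro ⟨κ, hκ, h⟩
  obtain ⟨i, hi⟩ := exists_S₈_neg
  set ξ : E3 := eAx i
  have hξ : ‖ξ‖ = 1 := norm_eAx i
  set B : ℝ := |S₁₄ ξ|
  set a : ℝ := max 1 (B / (-S₈ ξ) + 1) with ha_def
  have ha1 : 1 ≤ a := le_max_left _ _
  have ha : 0 < a := by positivity
  have ha' : a ≠ 0 := ha.ne'
  have hneg : 0 < -S₈ ξ := by linarith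
  -- the witness data
  have hS : Sites a constHagg (zU (4 * a / 5)) = (La ha' : Set E3) := sites_const_zU ha' (ha45 ha')
  have hW : 47 / 50 ≤ a ∧ IsHaggSeq constHagg ∧ HeightBox a (zU (4 * a / 5)) :=
    ⟨by linarith, isHaggSeq_const, heightBox_zU (by linarith) (by linarith)⟩
  have hF : ForceBalanced a constHagg (zU (4 * a / 5)) :=
    forceBalanced_of_sites_eq (La ha') (finrank_fccLat _ _) hS
  have hsupp : Function.support (uS ξ) ⊆ Sites a constHagg (zU (4 * a / 5)) :=
    (support_uS ξ).trans (by
      intro p hp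
      rw [Set.mem_singleton_iff] at hp
      subst hp
      rw [hS]
      exact (La ha').zero_mem)
  have key := h a constHagg (zU (4 * a / 5)) hW hF (uS ξ) (finite_support_uS ξ) hsupp
  -- the second variation of the witness
  have hmin : ∀ y ∈ La ha', y ≠ 0 → (1 / 2 : ℝ) ≤ ‖y‖ := fun y hy hy0 => norm_ge_of_mem_La ha1 hy hy0
  rw [hessForm_single (La ha') (finrank_fccLat _ _) hS hmin hξ, tsum_Hrow_La ha1 hξ] at key
  -- sign of a⁻⁸ S₈ + a⁻¹⁴ S₁₄
  have hainv : 0 < a⁻¹ := inv_pos.2 ha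
  have hainv1 : a⁻¹ ≤ 1 := inv_le_one_of_one_le₀ ha1
  have hgt : B < a * (-S₈ ξ) := by
    have h1 : B / (-S₈ ξ) + 1 ≤ a := le_max_right _ _
    have h2 : B / (-S₈ ξ) < a := by linarith
    exact (div_lt_iff₀ hneg).1 h2
  have h6 : (a⁻¹) ^ 6 ≤ a⁻¹ := pow_le_of_le_one hainv.le hainv1 (by norm_num)
  have hS14 : S₁₄ ξ ≤ B := le_abs_self _
  have hB : 0 ≤ B := abs_nonneg _
  -- a⁻¹⁴ S₁₄ ≤ a⁻¹⁴ B ≤ a⁻⁸ · a⁻¹ · B < a⁻⁸ · (−S₈)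
  have hstep : (a⁻¹) ^ 14 * S₁₄ ξ < (a⁻¹) ^ 8 * (-S₈ ξ) := by
    have e14 : (a⁻¹) ^ 14 = (a⁻¹) ^ 8 * (a⁻¹) ^ 6 := by ring
    have h8pos : 0 < (a⁻¹) ^ 8 := by positivity
    have hlt : a⁻¹ * B < -S₈ ξ := by
      rw [inv_mul_lt_iff₀ ha]; exact hgt
    calc (a⁻¹) ^ 14 * S₁₄ ξ ≤ (a⁻¹) ^ 14 * B := by gcongr
      _ = (a⁻¹) ^ 8 * ((a⁻¹) ^ 6 * B) := by rw [e14]; ring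
      _ ≤ (a⁻¹) ^ 8 * (a⁻¹ * B) := by gcongr
      _ < (a⁻¹) ^ 8 * (-S₈ ξ) := by gcongr
  have hnn := nnForm_nonneg a constHagg (zU (4 * a / 5)) (uS ξ)
  have hκnn : 0 ≤ κ * nnForm a constHagg (zU (4 * a / 5)) (uS ξ) := mul_nonneg hκ.le hnn
  nlinarith

end Dilation

end Summit.AtomisticToContinuum.Crystallization.Theorems.UniformPolytypeStabilityNegative

end
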